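import Literature.Topology.FourManifolds.LinkingNumberTorusClass
import Literature.Topology.FourManifolds.TubeOrientationTransport
import Literature.AlgebraicTopology.SingularHomology.LocalHomologyMayerVietorisCriteria
import HarnessLib

/-!
# The torus classes of all oriented tubes come from one class of the model punctured tube

Topic `Literature/Topology/FourManifolds`; part of the proof of the symmetry of the linking number
(`Knot.HasLinkingNumber.symm`, Rolfsen, *Knots and Links* (1976), §5.D Thm. 5.D.1), see
`LinkingNumberTorusClass.lean` for the plan and `TubeOrientationTransport.lean` for the
orientation input. For an oriented tubular neighbourhood `ν : S¹ × ℝ² ↪ S³` of a knot `K`, the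
torus class `torusClass ν μ ∈ H₂(N ∖ K; ℤ)` (`N = ν(S¹ × ℝ²)`; the Mayer–Vietoris image of the
fundamental class `[S³]`, Hatcher, *Algebraic Topology* (2002), §2.2) is the push-forward along `ν`
of a class of the model punctured tube `S¹ × (ℝ² ∖ 0)`; this file proves that **one and the same
model class serves all oriented tubes of all knots** (`exists_common_modelTorusClass`):

1. Unwinding the connecting map (Hatcher p. 150), `torusClass ν μ = ∂ ω'` for the excised
   fundamental class `ω' ∈ H₃(N, N ∖ K)`, whose point restrictions are the local orientations
   `μ_x`, `x ∈ K` (Hatcher Thm. 3.26).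
2. Transported to the model by the homeomorphism `ν : S¹ × ℝ² ≅ N`, the class
   `ω ∈ H₃(S¹ × ℝ² | S¹ × 0)` has point restrictions `c` with `ν_* c = μ_{ν m}`; by
   `Knot.TubularNbhd.map_localClass_eq_of_map_localClass_eq` (all oriented tubes transport the
   same local orientation) the classes of two tubes have the same point restrictions, hence are
   equal: a class of `H₃(X | C)` along a compact set `C` of a `3`-manifold is determined by its
   point restrictions (Hatcher Lemma 3.27(b), tree `clocalHomology.ptDetermined_of_isCompact`).
3. By naturality of `∂`, both torus classes are the push-forwards of `τ = ∂ ω ∈ H₂(S¹ × (ℝ² ∖ 0))`.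

Everything is proved; the new data are the model sets `coreModel`, `puncturedModel` and the
restricted tube map `Knot.TubularNbhd.punct`. No named fact is introduced.

## References

* A. Hatcher, *Algebraic Topology*, CUP (2002), §2.2 p. 150, §2.1 (naturality of `∂`),
  Thm. 2.20, §3.3 Thm. 3.26, Lemma 3.27. [cite: HatcherAT2002, §3.3 Lemma 3.27]
* D. Rolfsen, *Knots and Links* (1976), §5.D Thm. 5.D.1. [cite: Rolfsen1976, §5.D Thm 5.D.1]
-/

noncomputable section

open CategoryTheory Set Function
open scoped Manifold Topology
open Literature.AlgebraicTopology.SingularHomology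

namespace Literature.Topology.FourManifolds

/-- Local notation: `𝔼 n` is the model Euclidean space `EuclideanSpace ℝ (Fin n)`. -/
local notation "𝔼 " n:arg => EuclideanSpace ℝ (Fin n)

/-- Local notation: `𝕊 n` is the unit sphere in `EuclideanSpace ℝ (Fin (n + 1))`. -/
local notation "𝕊 " n:arg => (Metric.sphere (0 : EuclideanSpace ℝ (Fin (n + 1))) 1)

/-! ### The model tube, its core and its punctured tube -/

/-- **The core** `S¹ × 0` of the model tube `S¹ × ℝ²`. [folklore] -/
def coreModel : Set ((𝕊 1) × 𝔼 2) := {m | m.2 = 0}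

/-- **The model punctured tube** `S¹ × (ℝ² ∖ 0)`, the complement of the core. [folklore] -/
abbrev puncturedModel : Set ((𝕊 1) × 𝔼 2) := coreModelᶜ

/-- Membership in the punctured model tube. [folklore] -/
theorem mem_puncturedModel {m : (𝕊 1) × 𝔼 2} : m ∈ puncturedModel ↔ m.2 ≠ 0 := Iff.rfl

/-- The core is compact. [folklore] -/
theorem isCompact_coreModel : IsCompact coreModel := by
  have : coreModel = (univ : Set (𝕊 1)) ×ˢ ({0} : Set (𝔼 2)) := by
    ext m; simp [coreModel]
  rw [this]
  exact isCompact_univ.prod isCompact_singleton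

namespace Knot.TubularNbhd

variable {K : Knot} (ν : Knot.TubularNbhd K)

/-- A tube point lies on the knot iff its fibre coordinate vanishes. [folklore] -/
theorem apply_mem_range_iff (m : (𝕊 1) × 𝔼 2) : ν m ∈ range ⇑K ↔ m.2 = 0 := by
  constructor
  · rintro ⟨x, hx⟩
    have h : ν (x, 0) = ν m := by rw [ν.coe_apply_zero x]; exact hx
    have := ν.isOpenEmbedding.injective h
    rw [← this]
  · intro h
    obtain ⟨x, w⟩ := m
    simp only at h
    subst h
    exact ⟨x, (ν.coe_apply_zero x).symm⟩

/-- **The tube map on the punctured model tube**, landing in the punctured tube `N ∖ K`.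
[folklore] -/
def punct : C(↥puncturedModel, ↥(range ⇑ν ∩ (range ⇑K)ᶜ)) where
  toFun m := ⟨ν m, mem_range_self _, fun h ↦ m.2 ((ν.apply_mem_range_iff m).1 h)⟩
  continuous_toFun := by
    refine Continuous.subtype_mk (ν.isOpenEmbedding.continuous.comp continuous_subtype_val) _

/-- The tube map on the punctured model tube, as a function. [folklore] -/
@[simp] theorem punct_apply_coe (m : ↥puncturedModel) : (ν.punct m : 𝕊 3) = ν m := rfl

/-! ### The homeomorphism onto the tube and the excised fundamental class -/

/-- The tube map as a homeomorphism `S¹ × ℝ² ≃ₜ N` onto its image. [folklore] -/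
def homeoRange : ((𝕊 1) × 𝔼 2) ≃ₜ ↥(range ⇑ν) := ν.isOpenEmbedding.isEmbedding.toHomeomorph

/-- The homeomorphism onto the tube, as a function. [folklore] -/
@[simp] theorem homeoRange_apply_coe (m : (𝕊 1) × 𝔼 2) : (ν.homeoRange m : 𝕊 3) = ν m := rfl

/-- The homeomorphism onto the tube carries the punctured model tube to `N ∖ K`. [folklore] -/
theorem mapsTo_homeoRange :
    MapsTo (ν.homeoRange : C((𝕊 1) × 𝔼 2, ↥(range ⇑ν))) puncturedModel
      (Subtype.val ⁻¹' (range ⇑K)ᶜ : Set ↥(range ⇑ν)) :=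
  fun m hm h ↦ hm ((ν.apply_mem_range_iff m).1 h)

/-- The inverse homeomorphism carries `N ∖ K` to the punctured model tube. [folklore] -/
theorem mapsTo_homeoRange_symm :
    MapsTo (ν.homeoRange.symm : C(↥(range ⇑ν), (𝕊 1) × 𝔼 2))
      (Subtype.val ⁻¹' (range ⇑K)ᶜ : Set ↥(range ⇑ν)) puncturedModel := by
  intro n hn h
  apply hn
  have e : (n : 𝕊 3) = ν (ν.homeoRange.symm n) := by
    rw [← homeoRange_apply_coe, Homeomorph.apply_symm_apply]
  show (n : 𝕊 3) ∈ range ⇑K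
  rw [e]
  exact (ν.apply_mem_range_iff _).2 h

/-- The homeomorphism onto the tube carries the punctured model tube off the preimage of the knot
(the same statement with the target written as a complement). [folklore] -/
theorem mapsTo_homeoRange' :
    MapsTo (ν.homeoRange : C((𝕊 1) × 𝔼 2, ↥(range ⇑ν))) coreModelᶜ
      ((Subtype.val ⁻¹' range ⇑K : Set ↥(range ⇑ν))ᶜ) :=
  fun m hm h ↦ hm ((ν.apply_mem_range_iff m).1 h)

/-- The inverse homeomorphism carries the complement of the preimage of the knot to the punctured
model tube. [folklore] -/
theorem mapsTo_homeoRange_symm' :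
    MapsTo (ν.homeoRange.symm : C(↥(range ⇑ν), (𝕊 1) × 𝔼 2))
      ((Subtype.val ⁻¹' range ⇑K : Set ↥(range ⇑ν))ᶜ) coreModelᶜ :=
  fun _ hn ↦ ν.mapsTo_homeoRange_symm hn

/-- **The excised fundamental class** `ω' ∈ H₃(N, N ∖ K; ℤ)` of the tube: the preimage of
`j_*[S³] ∈ H₃(S³, S³ ∖ K)` under the excision isomorphism (Hatcher 2002, Thm. 2.20). [cite: HatcherAT2002, Thm. 2.20] -/
def excisedClass (μ : HomologicalOrientation ℤ (𝕊 3) 3) :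
    relativeSingularHomology ℤ ℤ (↥(range ⇑ν)) (Subtype.val ⁻¹' (range ⇑K)ᶜ) 3 :=
  haveI := mayerVietoris.isIso_excisionMap ℤ ℤ (range ⇑ν) (range ⇑K)ᶜ
    (relativeSingularHomology.isIso_map_of_interior_union_interior_holds ℤ ℤ (𝕊 3))
    ν.interior_range_union_interior_compl 3
  inv (mayerVietoris.excisionMap ℤ ℤ (range ⇑ν) (range ⇑K)ᶜ 3)
    (relativeSingularHomology.ofAbsolute ℤ ℤ (𝕊 3) (range ⇑K)ᶜ 3 μ.fundamentalClass)

/-- The excised class excises back to `j_*[S³]`. [folklore] -/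
theorem excisionMap_excisedClass (μ : HomologicalOrientation ℤ (𝕊 3) 3) :
    mayerVietoris.excisionMap ℤ ℤ (range ⇑ν) (range ⇑K)ᶜ 3 (ν.excisedClass μ) =
      relativeSingularHomology.ofAbsolute ℤ ℤ (𝕊 3) (range ⇑K)ᶜ 3 μ.fundamentalClass := by
  haveI := mayerVietoris.isIso_excisionMap ℤ ℤ (range ⇑ν) (range ⇑K)ᶜ
    (relativeSingularHomology.isIso_map_of_interior_union_interior_holds ℤ ℤ (𝕊 3))
    ν.interior_range_union_interior_compl 3
  rw [excisedClass, ← ModuleCat.comp_apply, IsIso.inv_hom_id, ModuleCat.id_apply]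

/-- **The torus class is the boundary of the excised fundamental class**, pushed to `N ∩ (S³ ∖ K)`
(unwinding of the Mayer–Vietoris connecting map, Hatcher 2002, §2.2 p. 150). [cite: HatcherAT2002, §2.2 p. 150] -/
theorem torusClass_eq_map_δ_excisedClass (μ : HomologicalOrientation ℤ (𝕊 3) 3) :
    ν.torusClass μ = singularHomology.map ℤ ℤ (preimageValHomeomorph (range ⇑ν) (range ⇑K)ᶜ) 2
      (relativeSingularHomology.δ ℤ ℤ (↥(range ⇑ν)) (Subtype.val ⁻¹' (range ⇑K)ᶜ) 2
        (ν.excisedClass μ)) :=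
  rfl

/-! ### The model class of a tube -/

/-- **The model class** `ω ∈ H₃(S¹ × ℝ², S¹ × (ℝ² ∖ 0); ℤ)` of the tube: the excised fundamental
class transported by `ν⁻¹`. [folklore] -/
def modelFundClass (μ : HomologicalOrientation ℤ (𝕊 3) 3) :
    localHomologyOfSet ℤ ℤ ((𝕊 1) × 𝔼 2) coreModel 3 :=
  relativeSingularHomology.map ℤ ℤ (ν.homeoRange.symm : C(↥(range ⇑ν), (𝕊 1) × 𝔼 2))
    ν.mapsTo_homeoRange_symm 3 (ν.excisedClass μ)

/-- Transporting the model class back gives the excised class. [folklore] -/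
theorem map_homeoRange_modelFundClass (μ : HomologicalOrientation ℤ (𝕊 3) 3) :
    relativeSingularHomology.map ℤ ℤ (ν.homeoRange : C((𝕊 1) × 𝔼 2, ↥(range ⇑ν)))
      ν.mapsTo_homeoRange 3 (ν.modelFundClass μ) = ν.excisedClass μ := by
  rw [modelFundClass, ← ModuleCat.comp_apply, ← relativeSingularHomology.map_comp]
  have e : (ν.homeoRange : C((𝕊 1) × 𝔼 2, ↥(range ⇑ν))).comp
      (ν.homeoRange.symm : C(↥(range ⇑ν), (𝕊 1) × 𝔼 2)) = ContinuousMap.id _ := by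
    ext1 n
    exact ν.homeoRange.apply_symm_apply n
  rw [relativeSingularHomology.map_congr_left ℤ ℤ e _ (mapsTo_id _) 3,
    relativeSingularHomology.map_id, ModuleCat.id_apply]

/-- **Point restrictions of the model class are local orientations**: for `m` on the core,
`ν_* (ω|_m) = μ_{ν m}` (the excised class restricts to `j_*[S³]|_{ν m} = μ_{ν m}`,
Hatcher 2002, Thm. 3.26). [cite: HatcherAT2002, Thm. 3.26] -/
theorem map_restrictToPoint_modelFundClass (μ : HomologicalOrientation ℤ (𝕊 3) 3)
    {m : (𝕊 1) × 𝔼 2} (hm : m ∈ coreModel) :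
    relativeSingularHomology.map ℤ ℤ ν.toCMap (ν.mapsTo_toCMap m) 3
      (restrictToPoint ℤ ℤ hm 3 (ν.modelFundClass μ)) = μ.localClass (ν m) := by
  have hνm : ν m ∈ range ⇑K := (ν.apply_mem_range_iff m).2 hm
  have h₂ : MapsTo (ContinuousMap.id (𝕊 3)) ((range ⇑K)ᶜ : Set (𝕊 3)) ({ν m}ᶜ : Set (𝕊 3)) :=
    fun z hz ↦ Set.compl_subset_compl.2 (singleton_subset_iff.2 hνm) hz
  -- the two composites of pairs `(N, N ∖ K) → (S³, S³ ∖ ν m)` agree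
  have e : relativeSingularHomology.map ℤ ℤ (ν.homeoRange.symm : C(↥(range ⇑ν), (𝕊 1) × 𝔼 2))
      ν.mapsTo_homeoRange_symm 3 ≫ restrictToPoint ℤ ℤ hm 3 ≫
        relativeSingularHomology.map ℤ ℤ ν.toCMap (ν.mapsTo_toCMap m) 3 =
      mayerVietoris.excisionMap ℤ ℤ (range ⇑ν) (range ⇑K)ᶜ 3 ≫
        restrictToPoint ℤ ℤ (K := range ⇑K) hνm 3 := by
    show _ ≫ relativeSingularHomology.map ℤ ℤ (ContinuousMap.id _) _ 3 ≫ _ =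
      relativeSingularHomology.map ℤ ℤ (subsetIncl (range ⇑ν))
        (mapsTo_preimage Subtype.val (range ⇑K)ᶜ) 3 ≫
        relativeSingularHomology.map ℤ ℤ (ContinuousMap.id _) h₂ 3
    rw [← relativeSingularHomology.map_comp, ← relativeSingularHomology.map_comp,
      ← relativeSingularHomology.map_comp]
    refine HomologicalOrientationOfSmooth.map_congr_fun (ContinuousMap.ext fun n ↦ ?_) _ _ 3
    show ν (ν.homeoRange.symm n) = (n : 𝕊 3)
    rw [← homeoRange_apply_coe, Homeomorph.apply_symm_apply]
  have he := congrArg (fun φ ↦ φ (ν.excisedClass μ)) e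
  simp only [ModuleCat.comp_apply] at he
  rw [modelFundClass, he, excisionMap_excisedClass]
  show restrictLocal ℤ ℤ _ 3 (singularHomology.toLocalOfSet ℤ ℤ (𝕊 3) (range ⇑K) 3
    μ.fundamentalClass) = _
  rw [singularHomology.restrictLocal_toLocalOfSet]
  exact HomologicalOrientation.isFundamentalClass_fundamentalClass_holds (R := ℤ) (X := 𝕊 3) 3 μ
    (ν m)

/-- **The model classes of any two oriented tubes have the same point restrictions along the
core** (`map_localClass_eq_of_map_localClass_eq`: all oriented tubes transport the same local
orientation; injectivity of `ν_*` on local homology at a point). [folklore] -/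
theorem restrictToPoint_modelFundClass_eq {K₁ K₂ : Knot} (ν₁ : Knot.TubularNbhd K₁)
    (ν₂ : Knot.TubularNbhd K₂) (μ : HomologicalOrientation ℤ (𝕊 3) 3)
    {m : (𝕊 1) × 𝔼 2} (hm : m ∈ coreModel) :
    restrictToPoint ℤ ℤ hm 3 (ν₁.modelFundClass μ) = restrictToPoint ℤ ℤ hm 3 (ν₂.modelFundClass μ) := by
  have h₁ := ν₁.map_restrictToPoint_modelFundClass μ hm
  have h₂ := ν₂.map_restrictToPoint_modelFundClass μ hm
  have h₂' := Knot.TubularNbhd.map_localClass_eq_of_map_localClass_eq ν₂ ν₁ μ m _ h₂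
  have hinj : Function.Injective
      (relativeSingularHomology.map ℤ ℤ ν₁.toCMap (ν₁.mapsTo_toCMap m) 3) := by
    have hiso := localHomology.isIso_map_of_isOpenEmbedding_of_eq ℤ ℤ ν₁.toCMap ν₁.isOpenEmbedding
      m rfl 3
    exact (ModuleCat.mono_iff_injective _).1 hiso.mono_of_iso
  exact hinj (h₁.trans h₂'.symm)

/-! ### Point-determined classes along the knot -/

/-- A class of `H₃(X | C; ℤ)` along a compact subset `C` of a Hausdorff `3`-manifold with vanishing
point restrictions vanishes (Hatcher 2002, Lemma 3.27(b); the tree's concrete-model statement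
`clocalHomology.ptDetermined_of_isCompact` read through `localHomologyOfSet.cmpIso`).
[cite: HatcherAT2002, Lemma 3.27] -/
theorem eq_zero_of_forall_restrictToPoint_eq_zero {X : Type} [TopologicalSpace X] [T2Space X]
    [ChartedSpace (𝔼 3) X] {C : Set X} (hC : IsCompact C) (β : localHomologyOfSet ℤ ℤ X C 3)
    (h : ∀ (x : X) (hx : x ∈ C), restrictToPoint ℤ ℤ hx 3 β = 0) : β = 0 := by
  have hpt := (clocalHomology.ptDetermined_of_isCompact ℤ ℤ (show 1 ≤ 3 by norm_num) hC).2
    ((localHomologyOfSet.cmpIso ℤ ℤ X C 3).hom β) (fun x hx ↦ by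
      rw [localHomologyOfSet.res_cmpIso_hom_apply]
      have h' : restrictLocal ℤ ℤ (singleton_subset_iff.2 hx) 3 β = 0 := h x hx
      rw [h', map_zero])
  have := congrArg (localHomologyOfSet.cmpIso ℤ ℤ X C 3).inv hpt
  rwa [Iso.hom_inv_id_apply, map_zero] at this

/-- **The model classes of any two oriented tubes of any two knots coincide.** [folklore] -/
theorem modelFundClass_eq {K₁ K₂ : Knot} (ν₁ : Knot.TubularNbhd K₁) (ν₂ : Knot.TubularNbhd K₂)
    (μ : HomologicalOrientation ℤ (𝕊 3) 3) : ν₁.modelFundClass μ = ν₂.modelFundClass μ := by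
  -- transport the difference to the tube `N₁`, a `3`-manifold, along the knot (compact)
  haveI : ChartedSpace (𝔼 3) ↥(range ⇑ν₁) := inferInstanceAs
    (ChartedSpace (𝔼 3) ↥(⟨range ⇑ν₁, ν₁.isOpen_range⟩ : TopologicalSpace.Opens (𝕊 3)))
  set Φ : C((𝕊 1) × 𝔼 2, ↥(range ⇑ν₁)) := (ν₁.homeoRange : C((𝕊 1) × 𝔼 2, ↥(range ⇑ν₁))) with hΦ
  set Ψ : C(↥(range ⇑ν₁), (𝕊 1) × 𝔼 2) := (ν₁.homeoRange.symm : C(↥(range ⇑ν₁), (𝕊 1) × 𝔼 2))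
    with hΨ
  have hC : IsCompact (Subtype.val ⁻¹' range ⇑K₁ : Set ↥(range ⇑ν₁)) := by
    rw [Subtype.isCompact_iff]
    have e : Subtype.val '' (Subtype.val ⁻¹' range ⇑K₁ : Set ↥(range ⇑ν₁)) = range ⇑K₁ := by
      rw [image_preimage_eq_inter_range, Subtype.range_coe]
      exact inter_eq_left.2 ν₁.range_knot_subset_range
    rw [e]
    exact K₁.isCompact_range
  set ω : localHomologyOfSet ℤ ℤ ((𝕊 1) × 𝔼 2) coreModel 3 :=
    ν₁.modelFundClass μ - ν₂.modelFundClass μ with hω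
  have hω0 : ∀ (m : (𝕊 1) × 𝔼 2) (hmc : m ∈ coreModel), restrictToPoint ℤ ℤ hmc 3 ω = 0 := by
    intro m hmc
    rw [hω, map_sub, ν₁.restrictToPoint_modelFundClass_eq ν₂ μ hmc, sub_self]
  -- the transported difference has vanishing point restrictions
  set β : localHomologyOfSet ℤ ℤ (↥(range ⇑ν₁)) (Subtype.val ⁻¹' range ⇑K₁) 3 :=
    relativeSingularHomology.map ℤ ℤ Φ ν₁.mapsTo_homeoRange' 3 ω with hβ
  have hβ0 : β = 0 := by
    refine eq_zero_of_forall_restrictToPoint_eq_zero hC β fun n hn ↦ ?_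
    -- `n = Φ m` with `m` on the core
    set m := ν₁.homeoRange.symm n with hm
    have hmn : Φ m = n := ν₁.homeoRange.apply_symm_apply n
    have hmc : m ∈ coreModel := by
      show m.2 = 0
      rw [← ν₁.apply_mem_range_iff m]
      have e : ν₁ m = (n : 𝕊 3) := congrArg Subtype.val hmn
      rw [e]; exact hn
    have hpt : MapsTo Φ ({m}ᶜ : Set ((𝕊 1) × 𝔼 2)) ({n}ᶜ : Set ↥(range ⇑ν₁)) :=
      Literature.AlgebraicTopology.SingularHomology.mapsTo_compl_singleton_of_injective
        ν₁.homeoRange.injective hmn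
    have e : relativeSingularHomology.map ℤ ℤ Φ ν₁.mapsTo_homeoRange' 3 ≫
        restrictToPoint ℤ ℤ (K := Subtype.val ⁻¹' range ⇑K₁) hn 3 =
        restrictToPoint ℤ ℤ hmc 3 ≫ relativeSingularHomology.map ℤ ℤ Φ hpt 3 := by
      show _ ≫ relativeSingularHomology.map ℤ ℤ (ContinuousMap.id _) _ 3 =
        relativeSingularHomology.map ℤ ℤ (ContinuousMap.id _) _ 3 ≫ _
      rw [← relativeSingularHomology.map_comp, ← relativeSingularHomology.map_comp]
      exact HomologicalOrientationOfSmooth.map_congr_fun (ContinuousMap.ext fun _ ↦ rfl) _ _ 3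
    have he := congrArg (fun φ ↦ φ ω) e
    simp only [ModuleCat.comp_apply] at he
    rw [hβ, he, hω0 m hmc, map_zero]
  -- apply `Φ⁻¹_*`
  have e' : relativeSingularHomology.map ℤ ℤ Φ ν₁.mapsTo_homeoRange' 3 ≫
      relativeSingularHomology.map ℤ ℤ Ψ ν₁.mapsTo_homeoRange_symm' 3 = 𝟙 _ := by
    rw [← relativeSingularHomology.map_comp]
    have ec : Ψ.comp Φ = ContinuousMap.id _ := by
      ext1 m'
      exact ν₁.homeoRange.symm_apply_apply m'
    rw [HomologicalOrientationOfSmooth.map_congr_fun ec _ (mapsTo_id _) 3,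
      relativeSingularHomology.map_id]
  have he' := congrArg (fun φ ↦ φ ω) e'
  simp only [ModuleCat.comp_apply, ModuleCat.id_apply] at he'
  rw [← hβ, hβ0, map_zero] at he'
  exact sub_eq_zero.1 he'.symm

/-! ### The common model torus class -/

/-- The restriction of the homeomorphism onto the tube to the punctured model tube, followed by
the canonical identification, is `punct`. [folklore] -/
theorem preimageValHomeomorph_comp_subsetRestrict :
    (preimageValHomeomorph (range ⇑ν) (range ⇑K)ᶜ : C(_, ↥(range ⇑ν ∩ (range ⇑K)ᶜ))).comp
      (subsetRestrict (ν.homeoRange : C((𝕊 1) × 𝔼 2, ↥(range ⇑ν))) ν.mapsTo_homeoRange) =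
        ν.punct := by
  ext1 m
  rfl

/-- **The torus class is the push-forward along `ν` of `∂ ω`.** [folklore] -/
theorem torusClass_eq_map_punct (μ : HomologicalOrientation ℤ (𝕊 3) 3) :
    ν.torusClass μ = singularHomology.map ℤ ℤ ν.punct 2
      (relativeSingularHomology.δ ℤ ℤ ((𝕊 1) × 𝔼 2) puncturedModel 2 (ν.modelFundClass μ)) := by
  rw [torusClass_eq_map_δ_excisedClass, ← map_homeoRange_modelFundClass]
  have hnat := relativeSingularHomology.δ_naturality ℤ ℤ
    (ν.homeoRange : C((𝕊 1) × 𝔼 2, ↥(range ⇑ν))) ν.mapsTo_homeoRange 2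
  have h1 := congrArg (fun φ ↦ φ (ν.modelFundClass μ)) hnat
  simp only [ModuleCat.comp_apply] at h1
  have h1' : singularHomology.map ℤ ℤ (subsetRestrict (ν.homeoRange : C((𝕊 1) × 𝔼 2, ↥(range ⇑ν)))
      ν.mapsTo_homeoRange) 2
        (relativeSingularHomology.δ ℤ ℤ ((𝕊 1) × 𝔼 2) puncturedModel 2 (ν.modelFundClass μ)) =
      relativeSingularHomology.δ ℤ ℤ (↥(range ⇑ν)) (Subtype.val ⁻¹' (range ⇑K)ᶜ) 2
        (relativeSingularHomology.map ℤ ℤ (ν.homeoRange : C((𝕊 1) × 𝔼 2, ↥(range ⇑ν)))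
          ν.mapsTo_homeoRange 3 (ν.modelFundClass μ)) := h1
  rw [← h1', ← ModuleCat.comp_apply, ← singularHomology.map_comp,
    preimageValHomeomorph_comp_subsetRestrict]

/-- **The torus classes of all oriented tubes of all knots are push-forwards of one model class.**
For oriented tubular neighbourhoods `ν₁`, `ν₂` of knots `K₁`, `K₂` and a `ℤ`-orientation `μ` of
`S³` there is `τ ∈ H₂(S¹ × (ℝ² ∖ 0); ℤ)` with `torusClass νᵢ μ = (νᵢ)_* τ` for `i = 1, 2`
(`τ = ∂ ω` for the common model class `ω`). This is where the orientation convention `det_pos`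
of `Knot.TubularNbhd` enters the symmetry of the linking number (Rolfsen 1976, §5.D Thm. 5.D.1).
[cite: Rolfsen1976, §5.D Thm 5.D.1] -/
theorem exists_common_modelTorusClass {K₁ K₂ : Knot} (ν₁ : Knot.TubularNbhd K₁)
    (ν₂ : Knot.TubularNbhd K₂) (μ : HomologicalOrientation ℤ (𝕊 3) 3) :
    ∃ τ : singularHomology ℤ ℤ ↥puncturedModel 2,
      ν₁.torusClass μ = singularHomology.map ℤ ℤ ν₁.punct 2 τ ∧
        ν₂.torusClass μ = singularHomology.map ℤ ℤ ν₂.punct 2 τ :=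
  ⟨relativeSingularHomology.δ ℤ ℤ ((𝕊 1) × 𝔼 2) puncturedModel 2 (ν₁.modelFundClass μ),
    ν₁.torusClass_eq_map_punct μ, by rw [ν₁.modelFundClass_eq ν₂ μ]; exact ν₂.torusClass_eq_map_punct μ⟩

end Knot.TubularNbhd

end Literature.Topology.FourManifolds
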